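import Summits.QuantumFields.QCD.Theses.NestedDissectionSea

/-!
# `RobustYangMills`, line `local-ac-open-certificate` — stub `stub_localAC` AS FIRST TYPED is false

Deep-refute (drefute) negative lemma on the stub set of
`Summits/QuantumFields/QCD/Cruxes/RobustYangMills/Lines/local-ac-open-certificate.lean` (crux item
stmt-QuantumFields-13897, shared by NestedDissectionSea / HeavyThresholdYMBridge / AdaptiveBlockFermions),
skeleton revision 2026-08-16T02:39Z. STATUS: the lead RESHAPED §1 at 03:52Z in response to this finding
(evidence note 03:47Z): conjunct (b) now carries `DependsOn f {e | e ∈ Λ ∨ ζ e = ζ' e}` and (a)–(c)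
carry `[MeasurableSingletonClass G]`; both witnesses below are excluded by the reshaped signatures, which
survive the same attacks. This file records, in `_false_without_` format, why those two hypotheses are
load-bearing. §1 restates the 02:39Z toolkit VERBATIM (`spec`, `RangeControl`, `NearBlocks`,
`KernelACInW`, `KernelQuasiLocality`, `KernelDLR`, `LocalACToolkit`); then:

* `kernelQuasiLocality_false`, `kernelQuasiLocality_false'` : `¬ KernelQuasiLocality` — WITHOUT the
  dependence hypothesis the observable `f ∈ [0,1]` may read a far link, and the kernel `spec ρ β W Λ ζ`
  (a measure on FULL configurations, equal to `ζ` off `Λ`) shows it `ζ` resp. `ζ'`. Witnesses with no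
  Yang–Mills content: `G = U(1)` (`Matrix.unitaryGroup (Fin 1) ℂ`), `W = 0`, `β = 0`, `κ = η = 0`,
  `b = 1`, `m = 0`, `f U = [U e₀ = 1]`; (i) `R = Λ = ∅`, `ζ ≡ 1`, `ζ' ≡ -1` (kernels = Dirac masses,
  claim reads `1 ≤ e⁰ · 0`); (ii) `Lt = 7`, `R = {0}`, `Λ` = the links of block `0`, `ζ' = ζ` updated
  to `-1` at the far link based at `(3,0,0,0)` (kernels = glued product Haar, proper; same contradiction)
  — so the defect was the missing dependence hypothesis, not `R = ∅`. With the repair the stated constant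
  `e^{4ηe^{-κm}|R|}` is consistent (two tilts of one glued product Haar measure by functions
  `2|R|ηe^{-κ(m+2)}`-close in oscillation; Wilson plaquettes through `Λ` read only `1`-near links).
* `kernelDLR_false : ¬ KernelDLR` — WITHOUT a separation hypothesis the indiscrete two-element group
  `Gind` is admitted (continuity into the indiscrete topology is free; finite ⇒ compact, second
  countable; `borel = ⊥`); then the product σ-algebra on configurations is `⊥` and NO probability
  kernel is proper a.e. (`IsSpecification.proper`): the exceptional set is non-empty and its only
  measurable superset is `univ`. (`[MeasurableSingletonClass G]` + Borel forces `T₂` for a group.)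
* `localACToolkit_false : ¬ LocalACToolkit` (either defect) and `imp_of_localACToolkit`: the 02:39Z
  `Deployment := LocalACToolkit → …` (stub `stub_deployment`) was VACUOUSLY provable.

Conjunct (a) `KernelACInW` is not refuted (same exterior datum on both sides; under the indiscrete model
every activity and every measurable `f` are constant and (a) holds trivially).
-/

noncomputable section

open scoped BigOperators Topology ENNReal
open Filter MeasureTheory
open Literature.MathematicalPhysics.QuantumLattice Literature.MathematicalPhysics.AQFT
  Literature.MathematicalPhysics.QuantumFieldTheory
open Literature.Probability.LatticeModels (Specification IsSpecification IsGibbsMeasure glueWith)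

namespace Summit.QuantumFields.QCD.Theorems.RobustYangMills.Negative.LocalACToolkitFalse

/-! ## §1 The skeleton's toolkit statement AS FIRST TYPED (02:39Z), restated verbatim -/

section Spec

variable {G : Type} [Group G] [TopologicalSpace G] [IsTopologicalGroup G] [CompactSpace G]
  [MeasurableSpace G] [BorelSpace G]

/-- The perturbed torus specification (verbatim copy of the skeleton's `spec`). -/
def spec {N Lt : ℕ} [NeZero Lt] {b : ℕ} (ρ : G →* Matrix (Fin N) (Fin N) ℂ) (β : ℝ)
    (W : QuasiLocalGaugePerturbation 4 Lt G b) : Specification (Edge 4 Lt) G :=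
  fun Λ ζ => ((Measure.pi fun _ : ↥Λ => haarProbability G).map (glueWith Λ · ζ)).tilted
    fun U => -β * wilsonAction ρ U - W.total U

/-- Range control (h4) (verbatim copy of the skeleton's `RangeControl`). -/
def RangeControl {Lt : ℕ} [NeZero Lt] {b : ℕ} (W : QuasiLocalGaugePerturbation 4 Lt G b) : Prop :=
  ∀ X : Finset (Site 4 Lt), X ∈ polymers b → (∃ U : GaugeConfig 4 Lt G, W.act X U ≠ 0) →
    ∀ y ∈ X, ∀ y' ∈ X, ∀ i : Fin 4, (y i - y' i).val ≤ b * X.card ∨ (y' i - y i).val ≤ b * X.card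

/-- `M` blocks near `R` (verbatim copy of the skeleton's `NearBlocks`). -/
def NearBlocks {Lt : ℕ} (b : ℕ) (R : Finset (Site 4 Lt)) (M : ℕ) (y' : Site 4 Lt) : Prop :=
  ∃ y ∈ R, ∀ i : Fin 4, (y i - y' i).val ≤ b * M ∨ (y' i - y i).val ≤ b * M

/-- Toolkit conjunct (a) (verbatim copy of the 02:39Z skeleton `KernelACInW`, i.e. WITHOUT `[MeasurableSingletonClass G]`). -/
def KernelACInW : Prop :=
  ∀ (G : Type) [Group G] [TopologicalSpace G] [IsTopologicalGroup G] [CompactSpace G]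
    [MeasurableSpace G] [BorelSpace G] [SecondCountableTopology G]
    (N : ℕ) (ρ : G →* Matrix (Fin N) (Fin N) ℂ), Continuous ρ →
    ∀ (Lt : ℕ) [NeZero Lt] (b : ℕ) (β : ℝ) (W W' : QuasiLocalGaugePerturbation 4 Lt G b) (κ δ : ℝ),
      0 ≤ κ → (W - W').NormLE κ δ →
      ∀ R : Finset (Site 4 Lt), R ⊆ blockCorners b →
      ∀ Λ : Finset (Edge 4 Lt), (∀ e ∈ Λ, blockCorner b e.1 ∈ R) →
      ∀ (ζ : GaugeConfig 4 Lt G) (f : GaugeConfig 4 Lt G → ℝ), Measurable f → (∀ U, 0 ≤ f U ∧ f U ≤ 1) →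
        ∫ U, f U ∂(spec ρ β W Λ ζ) ≤ Real.exp (2 * δ * R.card) * ∫ U, f U ∂(spec ρ β W' Λ ζ) ∧
        ∫ U, f U ∂(spec ρ β W' Λ ζ) ≤ Real.exp (2 * δ * R.card) * ∫ U, f U ∂(spec ρ β W Λ ζ)

/-- Toolkit conjunct (b) (verbatim copy of the 02:39Z skeleton `KernelQuasiLocality`, i.e. WITHOUT `DependsOn f …` and `[MeasurableSingletonClass G]`). -/
def KernelQuasiLocality : Prop :=
  ∀ (G : Type) [Group G] [TopologicalSpace G] [IsTopologicalGroup G] [CompactSpace G]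
    [MeasurableSpace G] [BorelSpace G] [SecondCountableTopology G]
    (N : ℕ) (ρ : G →* Matrix (Fin N) (Fin N) ℂ), Continuous ρ →
    ∀ (Lt : ℕ) [NeZero Lt] (b : ℕ) (β : ℝ) (W : QuasiLocalGaugePerturbation 4 Lt G b) (κ η : ℝ),
      1 ≤ b → 0 ≤ κ → W.NormLE κ η → RangeControl W →
      ∀ R : Finset (Site 4 Lt), R ⊆ blockCorners b →
      ∀ Λ : Finset (Edge 4 Lt), (∀ e ∈ Λ, blockCorner b e.1 ∈ R) →
      ∀ (m : ℕ) (ζ ζ' : GaugeConfig 4 Lt G),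
        (∀ e : Edge 4 Lt, NearBlocks b R (m + 1) (blockCorner b e.1) → ζ e = ζ' e) →
      ∀ f : GaugeConfig 4 Lt G → ℝ, Measurable f → (∀ U, 0 ≤ f U ∧ f U ≤ 1) →
        ∫ U, f U ∂(spec ρ β W Λ ζ) ≤
          Real.exp (4 * (η * Real.exp (-(κ * m))) * R.card) * ∫ U, f U ∂(spec ρ β W Λ ζ')

/-- Toolkit conjunct (c) (verbatim copy of the 02:39Z skeleton `KernelDLR`, i.e. WITHOUT `[MeasurableSingletonClass G]`). -/
def KernelDLR : Prop :=
  ∀ (G : Type) [Group G] [TopologicalSpace G] [IsTopologicalGroup G] [CompactSpace G]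
    [MeasurableSpace G] [BorelSpace G] [SecondCountableTopology G]
    (N : ℕ) (ρ : G →* Matrix (Fin N) (Fin N) ℂ), Continuous ρ →
    ∀ (Lt : ℕ) [NeZero Lt] (b : ℕ) (β : ℝ) (W : QuasiLocalGaugePerturbation 4 Lt G b),
      IsSpecification (spec ρ β W) ∧ IsGibbsMeasure (spec ρ β W) (W.perturbedMeasure ρ β)

/-- The toolkit (verbatim copy of the 02:39Z skeleton `LocalACToolkit` = statement of `stub_localAC` as first typed). -/
def LocalACToolkit : Prop :=
  KernelACInW ∧ KernelQuasiLocality ∧ KernelDLR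

/-- At `β = 0`, `W = 0`, `Λ = ∅` the kernel is the Dirac mass at the exterior datum (any group). -/
theorem spec_zero_zero_empty {N Lt : ℕ} [NeZero Lt] {b : ℕ} (ρ : G →* Matrix (Fin N) (Fin N) ℂ)
    (ζ : GaugeConfig 4 Lt G) :
    spec ρ 0 (0 : QuasiLocalGaugePerturbation 4 Lt G b) ∅ ζ = Measure.dirac ζ := by
  have h0 : (fun U : GaugeConfig 4 Lt G =>
      -(0 : ℝ) * wilsonAction ρ U - (0 : QuasiLocalGaugePerturbation 4 Lt G b).total U) = fun _ => 0 := by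
    funext U; simp
  have hglue : (fun x : (↥(∅ : Finset (Edge 4 Lt)) → G) => glueWith ∅ x ζ) = fun _ => ζ := by
    funext x; funext e
    exact Literature.Probability.LatticeModels.glueWith_apply_not_mem _ _ _ (by simp)
  simp only [spec, h0, hglue, Measure.map_const, measure_univ, one_smul]
  exact tilted_const _ _

/-- At `β = 0`, `W = 0` the kernel is the glued product Haar measure (any `Λ`, any group). [folklore] -/
theorem spec_zero_zero {N Lt : ℕ} [NeZero Lt] {b : ℕ} (ρ : G →* Matrix (Fin N) (Fin N) ℂ)
    (Λ : Finset (Edge 4 Lt)) (ζ : GaugeConfig 4 Lt G) :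
    spec ρ 0 (0 : QuasiLocalGaugePerturbation 4 Lt G b) Λ ζ =
      (Measure.pi fun _ : ↥Λ => haarProbability G).map (glueWith Λ · ζ) := by
  have h0 : (fun U : GaugeConfig 4 Lt G =>
      -(0 : ℝ) * wilsonAction ρ U - (0 : QuasiLocalGaugePerturbation 4 Lt G b).total U) = fun _ => 0 := by
    funext U; simp
  haveI : IsProbabilityMeasure
      ((Measure.pi fun _ : ↥Λ => haarProbability G).map (glueWith Λ · ζ)) :=
    Measure.isProbabilityMeasure_map
      (Literature.Probability.LatticeModels.measurable_glueWith Λ ζ).aemeasurable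
  simp only [spec, h0]
  exact tilted_const _ _

/-- Properness in action: against the `β = 0`, `W = 0` kernel, an observable reading only an
EXTERIOR link `e₀ ∉ Λ` integrates to its value at the exterior datum (any `Λ`, any group). [folklore] -/
theorem integral_spec_zero_zero_of_not_mem {N Lt : ℕ} [NeZero Lt] {b : ℕ}
    (ρ : G →* Matrix (Fin N) (Fin N) ℂ) (Λ : Finset (Edge 4 Lt)) (ζ : GaugeConfig 4 Lt G)
    {e₀ : Edge 4 Lt} (he₀ : e₀ ∉ Λ) (φ : G → ℝ) (hφ : Measurable φ) :
    ∫ U, φ (U e₀) ∂(spec ρ 0 (0 : QuasiLocalGaugePerturbation 4 Lt G b) Λ ζ) = φ (ζ e₀) := by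
  have hfm : AEStronglyMeasurable (fun U : GaugeConfig 4 Lt G => φ (U e₀))
      ((Measure.pi fun _ : ↥Λ => haarProbability G).map (glueWith Λ · ζ)) :=
    (hφ.comp (measurable_pi_apply e₀)).aestronglyMeasurable
  rw [spec_zero_zero, integral_map
    (Literature.Probability.LatticeModels.measurable_glueWith Λ ζ).aemeasurable hfm]
  simp only [Literature.Probability.LatticeModels.glueWith_apply_not_mem _ _ _ he₀]
  simp

end Spec

/-! ## §2 Conjunct (b) is false: the observable may read a far link -/

/-- `U(1)` as the unitary `1 × 1` matrices (all instances of the conjunct's binder list are in the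
tree / Mathlib: compact, second countable, Borel, topological group). -/
abbrev U1 : Type := ↥(Matrix.unitaryGroup (Fin 1) ℂ)

/-- `-1 ≠ 1` in `U(1)`. [folklore] -/
theorem neg_one_ne_one_U1 : (-1 : U1) ≠ 1 := by
  intro h
  have := congrArg (fun u : U1 => (u : Matrix (Fin 1) (Fin 1) ℂ) 0 0) h
  rw [Unitary.coe_neg, Matrix.neg_apply] at this
  norm_num at this

/-- The zero perturbation satisfies the range-control clause (h4) (no non-vanishing activity). -/
theorem rangeControl_zero {G : Type} [Group G] [TopologicalSpace G] [IsTopologicalGroup G]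
    [CompactSpace G] [MeasurableSpace G] [BorelSpace G] {Lt : ℕ} [NeZero Lt] {b : ℕ} :
    RangeControl (0 : QuasiLocalGaugePerturbation 4 Lt G b) := by
  intro X _ hX
  obtain ⟨U, hU⟩ := hX
  exact (hU (QuasiLocalGaugePerturbation.zero_act X U)).elim

/-- **Conjunct (b) `KernelQuasiLocality` of `stub_localAC` AS FIRST TYPED is false** — the
dependence hypothesis on `f` (added by the lead's 03:52Z reshape) is load-bearing: without it the
observable may read a far link; witness in the module docstring. [folklore] -/
theorem kernelQuasiLocality_false : ¬ KernelQuasiLocality := by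
  intro h
  -- the far link read by the observable
  let e₀ : Edge 4 1 := ((fun _ => 0), 0)
  let ζ : GaugeConfig 4 1 U1 := fun _ => 1
  let ζ' : GaugeConfig 4 1 U1 := fun _ => -1
  let f : GaugeConfig 4 1 U1 → ℝ := fun U => if U e₀ = 1 then 1 else 0
  have hmeas : MeasurableSet {U : GaugeConfig 4 1 U1 | U e₀ = 1} :=
    (measurableSet_singleton (1 : U1)).preimage (measurable_pi_apply e₀)
  have hf : Measurable f := Measurable.ite hmeas measurable_const measurable_const
  have hf01 : ∀ U, 0 ≤ f U ∧ f U ≤ 1 := by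
    intro U; by_cases hU : U e₀ = 1 <;> simp [f, hU]
  have key := h U1 1 (unitaryFundamentalRep (Fin 1) ℂ) continuous_subtype_val 1 1 0
    (0 : QuasiLocalGaugePerturbation 4 1 U1 1) 0 0 le_rfl le_rfl
    (QuasiLocalGaugePerturbation.normLE_zero le_rfl) rangeControl_zero ∅ (Finset.empty_subset _)
    ∅ (by simp) 0 ζ ζ' (by rintro e ⟨y, hy, -⟩; simp at hy) f hf hf01
  rw [spec_zero_zero_empty, spec_zero_zero_empty, integral_dirac, integral_dirac] at key
  have h1 : f ζ = 1 := by simp [f, ζ]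
  have h2 : f ζ' = 0 := by simp [f, ζ', neg_one_ne_one_U1]
  rw [h1, h2, mul_zero] at key
  exact absurd key (by norm_num)

/-- The far site `(3,0,0,0)` of the torus `(ℤ/7)⁴`. [folklore] -/
def x₀ : Site 4 7 := fun i => if i = 0 then 3 else 0

/-- `(3,0,0,0)` is not `1`-near the block `{0}` at block scale `1` (coordinate `0` is `3` one way
round and `4` the other). [folklore] -/
theorem not_near_x₀ : ¬ NearBlocks 1 ({0} : Finset (Site 4 7)) 1 x₀ := by
  rintro ⟨y, hy, h⟩
  rw [Finset.mem_singleton] at hy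
  subst hy
  have h0 := h 0
  simp only [x₀, Pi.zero_apply, zero_sub, sub_zero, one_mul] at h0
  revert h0
  decide

/-- `x₀ ≠ 0`. [folklore] -/
theorem x₀_ne_zero : x₀ ≠ 0 := by
  intro hx
  have := congrFun hx 0
  simp only [x₀, Pi.zero_apply] at this
  revert this
  decide

/-- The far link `e₀ = ((3,0,0,0), 0)`. [folklore] -/
def e₀ : Edge 4 7 := (x₀, 0)

/-- The glued region: the four links of block `0` at block scale `1`. [folklore] -/
def Λ₀ : Finset (Edge 4 7) := polymerEdges 1 {0}

/-- Every glued link has its block corner in `R = {0}` (by rewriting only: the concrete finite set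
of all `4 · 7⁴` links must never be evaluated, so no hypothesis of type `e ∈ Λ₀` is introduced). [folklore] -/
theorem Λ₀_corner : ∀ e ∈ Λ₀, blockCorner 1 e.1 ∈ ({0} : Finset (Site 4 7)) := by
  simp only [Λ₀, mem_polymerEdges_iff, imp_self, implies_true]

/-- The far link is not glued. [folklore] -/
theorem e₀_not_mem : e₀ ∉ Λ₀ := by
  simpa [Λ₀, e₀, mem_polymerEdges_iff] using x₀_ne_zero

/-- Exterior datum `ζ ≡ 1`. [folklore] -/
def ζ₁ : GaugeConfig 4 7 U1 := fun _ => 1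

/-- Exterior datum `ζ' = ζ` updated to `-1` at the far link. [folklore] -/
def ζ₁' : GaugeConfig 4 7 U1 := Function.update ζ₁ e₀ (-1)

/-- The observable `f U = [U e₀ = 1]` reading only the far link. [folklore] -/
def f₁ : GaugeConfig 4 7 U1 → ℝ := fun U => if U e₀ = 1 then 1 else 0

/-- `f₁` is measurable. [folklore] -/
theorem measurable_f₁ : Measurable f₁ :=
  Measurable.ite ((measurableSet_singleton (1 : U1)).preimage (measurable_pi_apply e₀))
    measurable_const measurable_const

/-- `f₁ ∈ [0,1]`. [folklore] -/
theorem f₁_bounds (U : GaugeConfig 4 7 U1) : 0 ≤ f₁ U ∧ f₁ U ≤ 1 := by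
  unfold f₁; split_ifs <;> norm_num

/-- The two exterior data agree on every link that is `1`-near the block `{0}`. [folklore] -/
theorem ζ₁_agree (e : Edge 4 7) (he : NearBlocks 1 ({0} : Finset (Site 4 7)) (0 + 1) (blockCorner 1 e.1)) :
    ζ₁ e = ζ₁' e := by
  by_cases hee : e = e₀
  · subst hee
    exact absurd (by simpa [e₀] using he) not_near_x₀
  · simp [ζ₁', Function.update_of_ne hee]

/-- `∫ f₁ d(spec 0 0 Λ₀ ζ) = 1`: the far link carries the exterior value `1`. [folklore] -/
theorem integral_f₁_ζ₁ :
    ∫ U, f₁ U ∂(spec (unitaryFundamentalRep (Fin 1) ℂ) 0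
      (0 : QuasiLocalGaugePerturbation 4 7 U1 1) Λ₀ ζ₁) = 1 := by
  have h := integral_spec_zero_zero_of_not_mem (b := 1) (unitaryFundamentalRep (Fin 1) ℂ) Λ₀ ζ₁
    e₀_not_mem (fun g : U1 => if g = 1 then (1 : ℝ) else 0)
    (Measurable.ite (measurableSet_singleton (1 : U1)) measurable_const measurable_const)
  simpa [f₁, ζ₁] using h

/-- `∫ f₁ d(spec 0 0 Λ₀ ζ') = 0`: the far link carries the exterior value `-1`. [folklore] -/
theorem integral_f₁_ζ₁' :
    ∫ U, f₁ U ∂(spec (unitaryFundamentalRep (Fin 1) ℂ) 0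
      (0 : QuasiLocalGaugePerturbation 4 7 U1 1) Λ₀ ζ₁') = 0 := by
  have h := integral_spec_zero_zero_of_not_mem (b := 1) (unitaryFundamentalRep (Fin 1) ℂ) Λ₀ ζ₁'
    e₀_not_mem (fun g : U1 => if g = 1 then (1 : ℝ) else 0)
    (Measurable.ite (measurableSet_singleton (1 : U1)) measurable_const measurable_const)
  simpa [f₁, ζ₁', neg_one_ne_one_U1] using h

/-- **Conjunct (b) is false with a NON-EMPTY block set and a non-empty glued region as well**:
`Lt = 7`, `b = 1`, `R = {0}`, `Λ` = the four links of block `0`, `m = 0`, exterior data `ζ ≡ 1` and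
`ζ' = ζ` updated to `-1` at the far link `e₀ = ((3,0,0,0), 0)` (they agree on every link `1`-near
`R`), `f U = [U e₀ = 1]`: both kernels are glued product Haar measures (`spec_zero_zero`), proper, so
`∫ f = [ζ e₀ = 1] = 1` resp. `[ζ' e₀ = 1] = 0` (`integral_spec_zero_zero_of_not_mem`), and the claim
reads `1 ≤ e^0 · 0`. So the defect is the missing dependence hypothesis on `f`, not `R = ∅`. [folklore] -/
theorem kernelQuasiLocality_false' : ¬ KernelQuasiLocality := by
  intro h
  have key := h U1 1 (unitaryFundamentalRep (Fin 1) ℂ) continuous_subtype_val 7 1 0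
    (0 : QuasiLocalGaugePerturbation 4 7 U1 1) 0 0 le_rfl le_rfl
    (QuasiLocalGaugePerturbation.normLE_zero le_rfl) rangeControl_zero {0}
    (Finset.singleton_subset_iff.2 (zero_mem_blockCorners 1))
    Λ₀ Λ₀_corner 0 ζ₁ ζ₁' ζ₁_agree f₁ measurable_f₁ f₁_bounds
  rw [integral_f₁_ζ₁, integral_f₁_ζ₁', mul_zero] at key
  exact absurd key (by norm_num)

/-! ## §3 Conjunct (c) is false: no separation axiom, so the indiscrete two-element group is admitted -/

/-- The two-element group `ℤ/2` (multiplicatively) — to be equipped with the INDISCRETE topology. -/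
def Gind : Type := Multiplicative (ZMod 2)

/-- The group structure of `ℤ/2`. [folklore] -/
instance : Group Gind := inferInstanceAs (Group (Multiplicative (ZMod 2)))
/-- Decidable equality of `ℤ/2`. [folklore] -/
instance : DecidableEq Gind := inferInstanceAs (DecidableEq (Multiplicative (ZMod 2)))
/-- `ℤ/2` is finite. [folklore] -/
instance : Fintype Gind := inferInstanceAs (Fintype (Multiplicative (ZMod 2)))
/-- The INDISCRETE topology on `Gind`. [folklore] -/
instance : TopologicalSpace Gind := ⊤
/-- Every map into an indiscrete space is continuous, so `Gind` is a topological group. [folklore] -/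
instance : IsTopologicalGroup Gind where
  continuous_mul := continuous_top
  continuous_inv := continuous_top
/-- Finite, hence compact. [folklore] -/
instance : CompactSpace Gind := Finite.compactSpace
/-- The Borel σ-algebra of the indiscrete topology is `⊥`; we register `⊥` and prove `BorelSpace`. [folklore] -/
instance : MeasurableSpace Gind := ⊥

/-- The Borel σ-algebra of the indiscrete topology is the trivial one. [folklore] -/
theorem borel_Gind : borel Gind = ⊥ := by
  refine le_antisymm (MeasurableSpace.generateFrom_le fun s hs => ?_) bot_le
  rcases (TopologicalSpace.isOpen_top_iff s).1 hs with rfl | rfl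
  · exact MeasurableSet.empty
  · exact MeasurableSet.univ

/-- `Gind` with the registered `⊥` σ-algebra is a Borel space. [folklore] -/
instance : BorelSpace Gind := ⟨borel_Gind.symm⟩

/-- The identity element of `Gind`. [folklore] -/
def g₀ : Gind := Multiplicative.ofAdd (0 : ZMod 2)
/-- The non-identity element of `Gind`. [folklore] -/
def g₁ : Gind := Multiplicative.ofAdd (1 : ZMod 2)

/-- The two elements are distinct. [folklore] -/
theorem g₀_ne_g₁ : g₀ ≠ g₁ := by decide

/-- On configurations over `Gind` the product σ-algebra is `⊥`: only `∅` and `univ` are measurable. -/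
theorem measurableSet_gind_iff {ι : Type} (t : Set (ι → Gind)) (ht : MeasurableSet t) :
    t = ∅ ∨ t = Set.univ := by
  have hpi : (MeasurableSpace.pi : MeasurableSpace (ι → Gind)) = ⊥ := by
    unfold MeasurableSpace.pi
    exact iSup_eq_bot.2 fun a => MeasurableSpace.comap_bot
  have ht' : MeasurableSet[⊥] t := by rw [← hpi]; exact ht
  exact MeasurableSpace.measurableSet_bot_iff.1 ht'

/-- **Conjunct (c) `KernelDLR` of `stub_localAC` AS FIRST TYPED is false** — the separation
hypothesis (`[MeasurableSingletonClass G]`, added by the lead's 03:52Z reshape; `[T2Space G]` would do)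
is load-bearing: for the indiscrete two-element group no probability kernel on configurations is
proper a.e., so `spec ρ β W` is not an `IsSpecification`. [folklore] -/
theorem kernelDLR_false : ¬ KernelDLR := by
  intro h
  let ρ : Gind →* Matrix (Fin 1) (Fin 1) ℂ := 1
  have hρ : Continuous ρ := continuous_of_const fun a b => by simp [ρ]
  have hspec := (h Gind 1 ρ hρ 1 0 0 (0 : QuasiLocalGaugePerturbation 4 1 Gind 0)).1
  let ζ₁ : GaugeConfig 4 1 Gind := fun _ => g₁
  let ζ₀ : GaugeConfig 4 1 Gind := fun _ => g₀
  haveI := hspec.isProbability ∅ ζ₁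
  have hprop := hspec.proper ∅ ζ₁
  rw [ae_iff] at hprop
  obtain ⟨t, hsub, ht, ht0⟩ := exists_measurable_superset_of_null hprop
  have hmem : ζ₀ ∈ t := by
    refine hsub ?_
    simp only [Finset.notMem_empty, not_false_eq_true, forall_const, Set.mem_setOf_eq, not_forall]
    exact ⟨((fun _ => 0), 0), g₀_ne_g₁⟩
  rcases measurableSet_gind_iff t ht with rfl | rfl
  · exact hmem
  · exact one_ne_zero (measure_univ.symm.trans ht0)

/-! ## §4 The registered stub and its consumers -/

/-- **`stub_localAC` AS FIRST TYPED (02:39Z) is false**: its statement `LocalACToolkit` fails at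
conjunct (b) (and independently at conjunct (c)). [folklore] -/
theorem localACToolkit_false : ¬ LocalACToolkit := fun h => kernelQuasiLocality_false h.2.1

/-- The same through conjunct (c). [folklore] -/
theorem localACToolkit_false' : ¬ LocalACToolkit := fun h => kernelDLR_false h.2.2

/-- Corollary: every implication out of the toolkit as first typed — in particular the 02:39Z
skeleton's `Deployment := LocalACToolkit → PerturbedMixingEngine → WilsonGoodCertificate → …`
(stub `stub_deployment`) — was vacuously provable; with the reshaped toolkit it is not. [folklore] -/
theorem imp_of_localACToolkit (P : Prop) : LocalACToolkit → P := fun h => (localACToolkit_false h).elim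

end Summit.QuantumFields.QCD.Theorems.RobustYangMills.Negative.LocalACToolkitFalse

end
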